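import Summits.Ventures.CertifiedManyBodySolver.Observables.StiffnessApexTransportThermalFromGroundHalfFilling
import Literature.MathematicalPhysics.QuantumLattice.HubbardTTPrimeThermalHalfFillingHinge
import HarnessLib

/-!
# Ventures/CertifiedManyBodySolver — Observables/StiffnessApexTransportThermalHinge.lean

HONEST FRAMING: one-sided certified CEILINGS on the THERMAL uniform flux stiffness at ONE inverse temperature, HALF FILLING, using the THERMAL
half-filling hinge `t′K₂(ω_β) ≤ 0` (`Literature/…/HubbardTTPrimeThermalHalfFillingHinge`, Peierls–Bogoliubov + evenness of the sector pressure in `t′`);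
conditional BY NAME on the source row (thermal or `T = 0`); entropy price only for `T = 0` sources; CONTROL / CALIBRATION class; a ceiling never speaks
to presence; not a superconductivity verdict; no phase sentence. Zero compute, no definition, no claim node, no `sorry`.

Cell `pub/hubbard-downfold` (D-0096 (2) «T > 0» leg; D-0150 L-DF2), seat `hubbard-downfold-unc-2` (`prover-hubbard-downfold-unc-2-g18-0`). Two uses of the hinge:

* §1 THERMAL SOURCE, OWN WORD (completes `StiffnessApexTransportThermal` §2, whose own-word reader needed a `K₂` bracket): on the ray
  `β_A U_A = β_P U_P`, `β_A t′_A = (2β_A − β_P) t′_P`, hubbard-tc's route T-A input at the source `Re ω_A(k₀^{tt′_A}) ≤ 2c` on the thermal class at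
  `(β_A; 1, t′_A, U_A, 1)` gives `ObsThermalStiffnessSeqCeilingAtBeta t′_P U_P 1 β_P c` with the SAME constant — no bracket, no price;
* §2 `T = 0` SOURCE, CORNER OBJECTIVE, TARGET RIGHT OF THE CORNER (the «transport shadow» of an overhang / corner-objective row, thermally): a
  ground-state orbit-lower sentence for `−X₀(σ)` at `A = (t′_A, U_A, 1)` and a target `P = (t′_P, U_P)`, `U_P > U_A`, on the ray from the apex `(2σ, 0)`
  through `A` with `2σ − 2t′_P = c·t′_P`, `c ≥ 0` (`σ ≤ t′_P ≤ 0`) ⇒ `ObsThermalStiffnessSeqCeilingAtBeta t′_P U_P 1 β c'` for every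
  `c' ≥ −F + U_A·2H_b(1/2)/(4β(U_P − U_A))` (point form `…_of_groundSource_cornerObjective_orbitLower`; ROW → SLAB form
  `…_on_slab_of_cornerObjectiveOrbitLower`: sources `(s, U_A)`, `s ∈ [s₁, s₂]`, slab `[p, q] × [U_lo, U_hi]` with `σ ≤ p`, `q < 0`, `U_A < U_lo`,
  `s₁ ≤ 2σ + U_A(p − 2σ)/U_hi`, `2σ + U_A(q − 2σ)/U_lo ≤ s₂`, ONE constant priced at `U_lo`).

NOT here: `U_P = U_A`; doped densities (the hinge is a half-filling statement); any `T_c` sentence.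

References: E. H. Lieb, CMP 31 (1973) 327, §V [Lieb1973]; E. H. Lieb, F. Y. Wu, Physica A 321 (2003) 1, §1 eq. (3) [LiebWuPhysicaA2003];
T. Koma, H. Tasaki, J. Stat. Phys. 76 (1994) 745, §1 [KomaTasaki1994]; T. Hazra, N. Verma, M. Randeria, PRX 9 (2019) 031049, eq. (4) [HazraVermaRanderia2019];
D. J. Scalapino, S. R. White, S.-C. Zhang, PRB 47 (1993) 7995, §II [ScalapinoWhiteZhang1993].
-/

noncomputable section

namespace Summit.Ventures.CertifiedManyBodySolver.Observables

open Filter Topology Matrix Finset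
open Literature.MathematicalPhysics.QuantumLattice
open Literature.MathematicalPhysics.QuantumLattice.InfVolFermionState
open Literature.MathematicalPhysics.QuantumLattice.ThermodynamicLimit
open Literature.MathematicalPhysics.QuantumFieldTheory
open Literature.MathematicalPhysics.StatisticalMechanics
open Literature.MathematicalPhysics.StatisticalMechanics.KosterlitzThouless
open Literature.Probability.LatticeModels
open scoped ComplexConjugate ComplexOrder

/-! ## §1 Thermal source, own word: the iso-`βU` ray with no `K₂` bracket at half filling -/

section ThermalSource

variable {t'A UA t'P UP βA βP : ℝ}

/-- **OWN THERMAL WORD ⇒ LEAF UP THE RAY (half filling, no bracket).** `0 < β_P < β_A`, `β_A U_A = β_P U_P`, `0 ≤ U_A`, `β_A t′_A = (2β_A − β_P) t′_P`.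
hubbard-tc's route T-A input at the SOURCE, `Re ω_A(k₀^{tt′_A}) ≤ 2c` for every torus limit of the canonical sector Gibbs states at `(β_A; 1, t′_A, U_A, 1)`,
gives `ObsThermalStiffnessSeqCeilingAtBeta t′_P U_P 1 β_P c` — the hinge at the thermal source (`t′_A K₂(ω_A) ≤ 0`) makes the source's own word a word
for the target's objective, the thermal apex row moves it. [cite: Lieb1973, §V (5.2)–(5.4)] [cite: LiebWuPhysicaA2003, §1 eq. (3)] [cite: HazraVermaRanderia2019, eq. (4)] -/
theorem ObsThermalStiffnessSeqCeilingAtBeta_halfFilling_of_thermalApexSource_ownKinetic_le (hβP : 0 < βP) (hβ : βP < βA)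
    (hγ : βA * UA = βP * UP) (hUA : 0 ≤ UA) (hapex : βA * t'A = (2 * βA - βP) * t'P) {c : ℚ}
    (hbound : ∀ (ωA : InfVolFermionState 2) (LsA : ℕ → ℕ), Tendsto LsA atTop atTop →
      ωA.IsTorusLimitOfMixture (sectorGibbsCount 1) (fun L => sectorGibbsWeightTT' βA 1 t'A UA 1 L)
        (fun L => sectorGibbsVectorTT' 1 t'A UA 1 L) LsA →
      (ωA.expect (box 2 1) (kinBondObsTT t'A)).re ≤ 2 * ((c : ℚ) : ℝ)) :
    ObsThermalStiffnessSeqCeilingAtBeta t'P UP 1 βP c := by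
  refine ObsThermalStiffnessSeqCeilingAtBeta_of_torusLimit_kinetic_le hβP zero_le_one one_le_two fun ω Ls hLs hω => ?_
  have hfl := IsTorusLimitOfMixture.le_meanEnergy_twice_tPrime_of_forall_source_ownWord_thermal_halfFilling (t := 1) hβP hβ hγ
    hUA hapex (ℓ := -4 * ((c : ℚ) : ℝ)) (fun ωA LsA hLsA hωA => ?_) hω hLs
  · rw [re_expect_kinBondObsTT_eq_of_isD4Invariant hω.isTranslationInvariant (hω.isD4Invariant_of_sectorGibbs 1 t'P UP 1 βP hLs) t'P]
    have hco := InfVolFermionState.meanEnergy_hubbardTTPrime_eq_coords ω 1 (2 * t'P) 0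
    rw [one_mul, zero_mul, add_zero] at hco
    rw [← hco]
    linarith
  · have h := hbound ωA LsA hLsA hωA
    rw [re_expect_kinBondObsTT_eq_of_isD4Invariant hωA.isTranslationInvariant
      (hωA.isD4Invariant_of_sectorGibbs 1 t'A UA 1 βA hLsA) t'A] at h
    have hco := InfVolFermionState.meanEnergy_hubbardTTPrime_eq_coords ωA 1 (2 * t'A) 0
    rw [one_mul, zero_mul, add_zero] at hco
    rw [← hco] at h
    linarith

end ThermalSource

/-! ## §2 `T = 0` source with the CORNER objective, thermal target to the right of the corner (the overhang shadow) -/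

section CornerShadow

variable {t'A UA t'P UP σ β : ℝ}

/-- **CORNER-OBJECTIVE `T = 0` SOURCE ⇒ THERMAL LEAF RIGHT OF THE CORNER (point form, half filling).** `0 ≤ U_A < U_P`, `0 < β`;
`U_P t′_A − U_A t′_P = 2σ(U_P − U_A)` (the target on the ray from the apex `(2σ, 0)` through the source) and `2σ − 2t′_P = c·t′_P`, `c ≥ 0`; a ground-state
orbit-lower sentence `F ≤ |D₄|⁻¹ Σ_γ Re ω_γ(−X₀(σ))` on the source class at `(t′_A, U_A, 1)` (any `U`-slot `Uo`). Then `ObsThermalStiffnessSeqCeilingAtBeta t′_P U_P 1 β c'`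
for every `c' ≥ −F + U_A·(2H_b(1/2)/β)/(U_P − U_A)/4`. [cite: KomaTasaki1994, §1] [cite: LiebWuPhysicaA2003, §1 eq. (3)] [cite: ScalapinoWhiteZhang1993, §II] -/
theorem ObsThermalStiffnessSeqCeilingAtBeta_halfFilling_of_groundSource_cornerObjective_orbitLower (Uo : ℝ) (hβ : 0 < β)
    (hUA : 0 ≤ UA) (hU : UA < UP) (hκ : UP * t'A - UA * t'P = 2 * σ * (UP - UA)) {c : ℝ} (hc : 0 ≤ c)
    (hσ : 2 * σ - 2 * t'P = c * t'P) {F : ℝ}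
    (horb : ∀ (ω : InfVolFermionState 2) (Ls : ℕ → ℕ) (ψ : ∀ L, Fock (Orb (FermionTorus 2 L))),
      Tendsto Ls atTop atTop →
      (∀ j, IsGroundStateInSector (hubbardTorusTT' (Ls j) 1 t'A UA) (rectN 1 (Ls j)) 0 (ψ (Ls j))) →
      (∀ j, star (ψ (Ls j)) ⬝ᵥ ψ (Ls j) = 1) → ω.IsTorusLimitOf ψ Ls →
      F ≤ ((Finset.univ : Finset (DihedralGroup 4)).card : ℝ)⁻¹ * ∑ g ∈ (Finset.univ : Finset (DihedralGroup 4)),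
        (ω.expect (d4ShiftSet g 0 (box 2 7)) (fermionEmbed (PolySite.d4Emb g 0 (box 2 7)) (-oddMomentObsTT σ Uo 0))).re)
    (c' : ℚ) (hc' : -F + UA * (2 * Real.binEntropy ((1 : ℝ) / 2) / β) / (UP - UA) / 4 ≤ ((c' : ℚ) : ℝ)) :
    ObsThermalStiffnessSeqCeilingAtBeta t'P UP 1 β c' := by
  refine ObsThermalStiffnessSeqCeilingAtBeta_of_torusLimit_kinetic_le hβ zero_le_one one_le_two fun ω Ls hLs hω => ?_
  have hfl := IsTorusLimitOfMixture.le_meanEnergy_twice_tPrime_thermal_of_forall_groundSource_cornerObjective_halfFilling 1 t'A t'P σ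
    hUA hU hβ hκ hc hσ (ℓ := 4 * F) (fun ωA LsA ψA hLsA hψA h1A hωA => ?_) hω hLs
  · rw [re_expect_kinBondObsTT_eq_of_isD4Invariant hω.isTranslationInvariant (hω.isD4Invariant_of_sectorGibbs 1 t'P UP 1 β hLs) t'P]
    have hco := InfVolFermionState.meanEnergy_hubbardTTPrime_eq_coords ω 1 (2 * t'P) 0
    rw [one_mul, zero_mul, add_zero] at hco
    rw [← hco]
    have e12 : 2 * Real.binEntropy (1 / 2) / β = 2 * Real.binEntropy ((1 : ℝ) / 2) / β := rfl
    linarith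
  · have h := horb ωA LsA ψA hLsA hψA h1A hωA
    rw [orbitMean_re_expect_neg_oddMomentTT_lam_zero hωA.isTranslationInvariant] at h
    linarith

/-- **The shadow source of a slab point**: for the target `(tp, U)` and the corner hopping `σ`, the source `2σ + U_A(tp − 2σ)/U` at the station `U_A`
satisfies the ray identity `U·s − U_A·tp = 2σ(U − U_A)` (`U ≠ 0`). [folklore] -/
theorem cornerShadow_source_eq {U : ℝ} (hU : U ≠ 0) (σ UA tp : ℝ) :
    U * (2 * σ + UA * (tp - 2 * σ) / U) - UA * tp = 2 * σ * (U - UA) := by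
  field_simp
  ring

/-- **SLAB FORM OF THE SHADOW.** Corner hopping `σ ≤ 0`, station `0 ≤ U_A`, a ground-state orbit-lower FAMILY for the fixed objective `−X₀(σ)` with value `F` on the
classes `(s, U_A, 1)`, `s ∈ [s₁, s₂]` (an overhang / corner-objective bundle of record); a slab `[p, q] × [U_lo, U_hi]` with `σ ≤ p`, `q < 0`, `U_A < U_lo ≤ U_hi`,
whose shadow sources lie in the family: `s₁ ≤ 2σ + U_A(p − 2σ)/U_hi` and `2σ + U_A(q − 2σ)/U_lo ≤ s₂`. Then for every `β > 0` and ONE constant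
`c' ≥ −F + U_A·(2H_b(1/2)/β)/(U_lo − U_A)/4`: `ObsThermalStiffnessSeqCeilingAtBeta tp U 1 β c'` on the slab. [cite: KomaTasaki1994, §1] [cite: ScalapinoWhiteZhang1993, §II] -/
theorem ObsThermalStiffnessSeqCeilingAtBeta_halfFilling_on_slab_of_cornerObjectiveOrbitLower (Uo : ℝ) {s₁ s₂ p q Ulo Uhi : ℝ}
    (hβ : 0 < β) (hσ : σ ≤ 0) (hUA : 0 ≤ UA) (hlo : UA < Ulo) (hlh : Ulo ≤ Uhi) (hp : σ ≤ p) (hq : q < 0)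
    (hs₁ : s₁ ≤ 2 * σ + UA * (p - 2 * σ) / Uhi) (hs₂ : 2 * σ + UA * (q - 2 * σ) / Ulo ≤ s₂) {F : ℚ}
    (hrows : ∀ s ∈ Set.Icc s₁ s₂, ∀ (ω : InfVolFermionState 2) (Ls : ℕ → ℕ) (ψ : ∀ L, Fock (Orb (FermionTorus 2 L))),
      Tendsto Ls atTop atTop →
      (∀ j, IsGroundStateInSector (hubbardTorusTT' (Ls j) 1 s UA) (rectN 1 (Ls j)) 0 (ψ (Ls j))) →
      (∀ j, star (ψ (Ls j)) ⬝ᵥ ψ (Ls j) = 1) → ω.IsTorusLimitOf ψ Ls →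
      ((F : ℚ) : ℝ) ≤ ((Finset.univ : Finset (DihedralGroup 4)).card : ℝ)⁻¹ * ∑ g ∈ (Finset.univ : Finset (DihedralGroup 4)),
        (ω.expect (d4ShiftSet g 0 (box 2 7)) (fermionEmbed (PolySite.d4Emb g 0 (box 2 7)) (-oddMomentObsTT σ Uo 0))).re)
    (c' : ℚ) (hc' : -((F : ℚ) : ℝ) + UA * (2 * Real.binEntropy ((1 : ℝ) / 2) / β) / (Ulo - UA) / 4 ≤ ((c' : ℚ) : ℝ)) :
    ∀ tp ∈ Set.Icc p q, ∀ U ∈ Set.Icc Ulo Uhi, ObsThermalStiffnessSeqCeilingAtBeta tp U 1 β c' := by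
  intro tp htp U hU
  have hUlo : 0 < Ulo := hUA.trans_lt hlo
  have hU0 : 0 < U := hUlo.trans_le hU.1
  have hUhi : 0 < Uhi := hUlo.trans_le hlh
  have hUAU : UA < U := hlo.trans_le hU.1
  have htp0 : tp < 0 := lt_of_le_of_lt htp.2 hq
  -- the shadow source and its membership in the family
  set s : ℝ := 2 * σ + UA * (tp - 2 * σ) / U with hs
  have hnum_p : 0 ≤ p - 2 * σ := by linarith
  have hnum : 0 ≤ tp - 2 * σ := by linarith [htp.1]
  have hmem : s ∈ Set.Icc s₁ s₂ := by
    constructor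
    · -- `s₁ ≤ 2σ + U_A(p−2σ)/U_hi ≤ 2σ + U_A(tp−2σ)/U`
      have h1 : UA * (p - 2 * σ) / Uhi ≤ UA * (tp - 2 * σ) / Uhi :=
        div_le_div_of_nonneg_right (mul_le_mul_of_nonneg_left (by linarith [htp.1]) hUA) hUhi.le
      have h2 : UA * (tp - 2 * σ) / Uhi ≤ UA * (tp - 2 * σ) / U :=
        div_le_div_of_nonneg_left (mul_nonneg hUA hnum) hU0 hU.2
      rw [hs]; linarith
    · have h1 : UA * (tp - 2 * σ) / U ≤ UA * (q - 2 * σ) / U :=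
        div_le_div_of_nonneg_right (mul_le_mul_of_nonneg_left (by linarith [htp.2]) hUA) hU0.le
      have h2 : UA * (q - 2 * σ) / U ≤ UA * (q - 2 * σ) / Ulo :=
        div_le_div_of_nonneg_left (mul_nonneg hUA (by linarith [htp.1, htp.2])) hUlo hU.1
      rw [hs]; linarith
  -- the hinge coefficient at the target: `2σ − 2tp = c·tp` with `c = (2σ − 2tp)/tp ≥ 0` (`tp < 0`)
  have hprice : UA * (2 * Real.binEntropy ((1 : ℝ) / 2) / β) / (U - UA) / 4 ≤
      UA * (2 * Real.binEntropy ((1 : ℝ) / 2) / β) / (Ulo - UA) / 4 := by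
    have hent : 0 ≤ 2 * Real.binEntropy ((1 : ℝ) / 2) / β :=
      div_nonneg (mul_nonneg (by norm_num) (Real.binEntropy_nonneg (by norm_num) (by norm_num))) hβ.le
    exact div_le_div_of_nonneg_right
      (div_le_div_of_nonneg_left (mul_nonneg hUA hent) (sub_pos.2 hlo) (by linarith [hU.1])) (by norm_num)
  exact ObsThermalStiffnessSeqCeilingAtBeta_halfFilling_of_groundSource_cornerObjective_orbitLower Uo hβ hUA hUAU
    (cornerShadow_source_eq hU0.ne' σ UA tp) (c := (2 * σ - 2 * tp) / tp)
    (div_nonneg_of_nonpos (by linarith [htp.1]) htp0.le) (div_mul_cancel₀ _ htp0.ne).symm (hrows s hmem) c' (by linarith)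

end CornerShadow

end Summit.Ventures.CertifiedManyBodySolver.Observables

end
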